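import Summits.ResolutionOfSingularities.ResolutionOfSingularities.Theorems.EquisingularLiftEquisingularLiftNatSmoothConeBlowupStalk
import Summits.ResolutionOfSingularities.ResolutionOfSingularities.Theorems.EquisingularLiftEquisingularLiftNatTangentConeFibre
import HarnessLib

/-!
# [OURS · L1 W4.5(b) · EL♮(3)] T-EBETA-PRIME, part 6: the POINT-BLOW-UP specialisation — one blow-up of a closed regular point
# resolves a hypersurface with smooth projectivised tangent cone, over the point (hypotheses in regular-system-of-parameters form)

Support file of the crux chain w45b (cell `res-hironaka`, LADDER-RESOLUTION rung L, slot W4.5(b)), working crux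
**EL♮ = `Theses.EquisingularLift.EquisingularLiftNat`** (stmt-ResolutionOfSingularities-20038) and its `n = 3` child
`EquisingularLiftNatThree` (stmt-ResolutionOfSingularities-20148), registered stub `stub_elnat_three_isolated_nontc`. OURS; NOT a
statement of any manuscript; AI-written, weaker than expert review. Filed `--supports stmt-ResolutionOfSingularities-20148 --as helper`
by res-L1-w45b-stub-3 (object T-EBETA-PRIME; parts 1–5 = p511641, p512906, p514128, p516994, p517941).

WHAT. Part 4 (`isRegularLocalRing_stalk_quotient_strictTransform_of_mem_span`, …NatSmoothConeBlowupStalk) asks for the centre's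
stalk `J_p = (c)` with `c` QUASI-REGULAR, `R/(c)` a DOMAIN and a REGULAR ring. For the blow-up of a closed point `p` of a scheme
regular at `p` these follow from «`c` is a regular system of parameters»: `(c) = 𝔪_p` with `r = dim 𝒪_{X,p}` members
(res-type-097's `isQuasiRegular_of_span_eq_maximalIdeal`, `isDomain_quotient_span_of_span_eq_maximalIdeal`, p514857; `R/𝔪` is a
field, hence regular). This file packages that:

* `isRegularRing_quotient_span_of_span_eq_maximalIdeal` — `R/(c)` is a regular ring when `(c) = 𝔪_R`;
* **`isRegularLocalRing_stalk_quotient_strictTransform_point`** — `τ : X' → X` a blow-up along `J` with `J_p = 𝔪_p` at the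
  closed point `p = τ x'` (`𝒪_{X,p}` regular of dimension `r`, `c` a regular system of parameters), `K_p = (Φ(c) + Ψ)` with `Φ` a
  form of degree `d`, `Φ̄ ≠ 0` over `κ(p)`, `Ψ ∈ 𝔪_p^{d+1}`, and the projectivised tangent cone `V(Φ̄) ⊂ ℙ^{r-1}_{κ(p)}` SMOOTH
  (Jacobian condition on every chart) ⇒ at every point `x'` of the strict transform over `p`, **`𝒪_{X',x'}/St_τ(K)_{x'}` is a regular
  local ring of dimension `dim 𝒪_{X',x'} − 1`** — the classical «an ordinary singularity with smooth tangent cone is resolved by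
  one point blow-up», locally over the point;
* **`isRegularLocalRing_stalk_quotient_strictTransform_point_tieCubic`** — the same for `r = 3` and the S-F tie cubic
  `Φ = v·T₀T₁(T₀+T₁) + w·T₂³` (`3, v̄, w̄` units): the (E-β′) centre `Bl_{q̃}(D)` over a tie point of the carrier `E_{O′} ≅ ℙ²_{O′}`.

References: Matsumura, *Commutative Ring Theory*, Thm. 14.2, 17.8; The Stacks Project, Tag 0804. Tree inputs: part 4 (p516994),
`…NatTangentConeFibre` (p514857, res-type-097), `…NatTieCubicBlowup` (p514128).
-/

set_option linter.dupNamespace false -- mandated namespace `Summit.<Summit>.<Problem>` of this single-conjunct summit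

noncomputable section

open CategoryTheory AlgebraicGeometry TopologicalSpace IsLocalRing
open Literature.AlgebraicGeometry.Resolution
open Summit.ResolutionOfSingularities.ResolutionOfSingularities.Cruxes.EquisingularLift.StrataSplit

namespace Summit.ResolutionOfSingularities.ResolutionOfSingularities.Cruxes.EquisingularLiftNat.Sections

universe u

/-- If `(c) = 𝔪_R` for a local ring `R`, then `R/(c)` (a field) is a regular ring. [folklore] -/
theorem isRegularRing_quotient_span_of_span_eq_maximalIdeal {R : Type u} [CommRing R] [IsLocalRing R] {r : ℕ}
    {c : Fin r → R} (hc𝔪 : Ideal.span (Set.range c) = maximalIdeal R) :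
    IsRegularRing (R ⧸ Ideal.span (Set.range c)) := by
  haveI : (Ideal.span (Set.range c)).IsMaximal := hc𝔪 ▸ maximalIdeal.isMaximal R
  letI : Field (R ⧸ Ideal.span (Set.range c)) := Ideal.Quotient.field (Ideal.span (Set.range c))
  haveI : IsRegularLocalRing (R ⧸ Ideal.span (Set.range c)) := inferInstance
  exact isRegularRing_of_isRegularLocalRing _

section Point

variable {X X' : Scheme.{u}} {τ : X' ⟶ X} {J : X.IdealSheafData}

/-- **One point blow-up resolves a hypersurface point with smooth projectivised tangent cone, over the point.** Let `τ : X' → X`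
be a blow-up along `J`, `X'` locally Noetherian, `x' ∈ X'` with `p = τ x' ∈ supp J`, `𝒪_{X,p}` a regular local ring of dimension `r`,
`c = (c₁, …, c_r)` a regular system of parameters (`(c) = 𝔪_p`) with `J_p = (c)` (the blow-up of the POINT `p` near `p`), and
`K_p = (Φ(c) + Ψ)` for a form `Φ` of degree `d` with `Φ̄ ≠ 0` over the residue field and `Ψ ∈ 𝔪_p^{d+1}` — so `V(Φ̄) ⊂ ℙ^{r-1}` is the
projectivised tangent cone of the hypersurface `V(K)` at `p`. If `V(Φ̄)` is SMOOTH (`1 ∈ (Φ̄_j) + (∂Φ̄_j/∂T_l : l ≠ j)` on every chart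
`j`), then at every point `x'` of the strict transform `V(St_τ(K))` over `p` the local ring `𝒪_{X',x'}/St_τ(K)_{x'}` is REGULAR, of
dimension `dim 𝒪_{X',x'} − 1`. [cite: Matsumura1987, Thm. 14.2] [cite: StacksProject, Tag 0804] [OURS · L1 W4.5b] T-EBETA-PRIME,
point form; NOT a statement of the manuscript. -/
theorem isRegularLocalRing_stalk_quotient_strictTransform_point [IsLocallyNoetherian X'] (hτ : IsBlowup τ J)
    (K : X.IdealSheafData) (x' : X') (hx' : τ x' ∈ (J.support : Set X))
    [IsRegularLocalRing (X.presheaf.stalk (τ x'))] {r : ℕ} (hr : ringKrullDim (X.presheaf.stalk (τ x')) = r)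
    (c : Fin r → X.presheaf.stalk (τ x')) (hc𝔪 : Ideal.span (Set.range c) = maximalIdeal (X.presheaf.stalk (τ x')))
    (hcJ : Ideal.span (Set.range c) = stalkIdeal J (τ x'))
    {d : ℕ} (Φ : MvPolynomial (Fin r) (X.presheaf.stalk (τ x'))) (hΦd : Φ.IsHomogeneous d)
    (hΦ : MvPolynomial.map (Ideal.Quotient.mk (Ideal.span (Set.range c))) Φ ≠ 0)
    {Ψ : X.presheaf.stalk (τ x')} (hΨ : Ψ ∈ Ideal.span (Set.range c) ^ (d + 1))
    (hK : stalkIdeal K (τ x') = Ideal.span {MvPolynomial.eval c Φ + Ψ})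
    (hJac : ∀ j : Fin r, (1 : MvPolynomial {l : Fin r // l ≠ j} (X.presheaf.stalk (τ x') ⧸ Ideal.span (Set.range c))) ∈
      Ideal.span {MvPolynomial.map (Ideal.Quotient.mk (Ideal.span (Set.range c))) (dehomogenize j Φ)} ⊔
        Ideal.span (Set.range fun l : {l : Fin r // l ≠ j} =>
          MvPolynomial.pderiv l (MvPolynomial.map (Ideal.Quotient.mk (Ideal.span (Set.range c))) (dehomogenize j Φ))))
    (hx'St : x' ∈ (strictTransformIdeal τ J K).support) :
    IsRegularLocalRing (X'.presheaf.stalk x' ⧸ stalkIdeal (strictTransformIdeal τ J K) x') ∧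
      ringKrullDim (X'.presheaf.stalk x' ⧸ stalkIdeal (strictTransformIdeal τ J K) x') + 1 =
        ringKrullDim (X'.presheaf.stalk x') := by
  have hc : IsQuasiRegular c := isQuasiRegular_of_span_eq_maximalIdeal hr c hc𝔪
  haveI : IsDomain (X.presheaf.stalk (τ x') ⧸ Ideal.span (Set.range c)) := isDomain_quotient_span_of_span_eq_maximalIdeal hc𝔪
  haveI : IsRegularRing (X.presheaf.stalk (τ x') ⧸ Ideal.span (Set.range c)) :=
    isRegularRing_quotient_span_of_span_eq_maximalIdeal hc𝔪
  exact isRegularLocalRing_stalk_quotient_strictTransform_of_mem_span hτ K x' hx' c hcJ hc Φ hΦd hΦ hΨ hK hJac hx'St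

/-- **The (E-β′) centre over an S-F tie point, point form.** As `isRegularLocalRing_stalk_quotient_strictTransform_point` with `r = 3`
(the carrier `E_{O′} ≅ ℙ²_{O′}` at a tie point `q̃`, regular of dimension `3`, regular system of parameters `c = (ℓ̃₁, ℓ̃₂, ϖ′)`) and
`K_{q̃} = (v·c₀c₁(c₀+c₁) + w·c₂³ + Ψ)`, `Ψ ∈ 𝔪⁴`, with `3`, `v̄`, `w̄` units of the residue field (residue characteristic `2` at S-F):
`𝒪_{X',x'}/St_τ(K)_{x'}` is a regular local ring at every point `x'` of the strict transform over `q̃`.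
[cite: Matsumura1987, Thm. 14.2] [cite: StacksProject, Tag 0804] [OURS · L1 W4.5b] K4.5e arm T certificate (1) over the tie
points; NOT a statement of the manuscript. -/
theorem isRegularLocalRing_stalk_quotient_strictTransform_point_tieCubic [IsLocallyNoetherian X'] (hτ : IsBlowup τ J)
    (K : X.IdealSheafData) (x' : X') (hx' : τ x' ∈ (J.support : Set X))
    [IsRegularLocalRing (X.presheaf.stalk (τ x'))] (hr : ringKrullDim (X.presheaf.stalk (τ x')) = (3 : ℕ))
    (c : Fin 3 → X.presheaf.stalk (τ x')) (hc𝔪 : Ideal.span (Set.range c) = maximalIdeal (X.presheaf.stalk (τ x')))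
    (hcJ : Ideal.span (Set.range c) = stalkIdeal J (τ x'))
    (v w : X.presheaf.stalk (τ x')) (h3 : IsUnit (3 : X.presheaf.stalk (τ x') ⧸ Ideal.span (Set.range c)))
    (hv : IsUnit (Ideal.Quotient.mk (Ideal.span (Set.range c)) v))
    (hw : IsUnit (Ideal.Quotient.mk (Ideal.span (Set.range c)) w))
    {Ψ : X.presheaf.stalk (τ x')} (hΨ : Ψ ∈ Ideal.span (Set.range c) ^ (3 + 1))
    (hK : stalkIdeal K (τ x') = Ideal.span {MvPolynomial.eval c
      (MvPolynomial.C v * (MvPolynomial.X 0 * MvPolynomial.X 1 * (MvPolynomial.X 0 + MvPolynomial.X 1)) +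
        MvPolynomial.C w * MvPolynomial.X 2 ^ 3 : MvPolynomial (Fin 3) (X.presheaf.stalk (τ x'))) + Ψ})
    (hx'St : x' ∈ (strictTransformIdeal τ J K).support) :
    IsRegularLocalRing (X'.presheaf.stalk x' ⧸ stalkIdeal (strictTransformIdeal τ J K) x') ∧
      ringKrullDim (X'.presheaf.stalk x' ⧸ stalkIdeal (strictTransformIdeal τ J K) x') + 1 =
        ringKrullDim (X'.presheaf.stalk x') := by
  have hc : IsQuasiRegular c := isQuasiRegular_of_span_eq_maximalIdeal hr c hc𝔪
  haveI : IsDomain (X.presheaf.stalk (τ x') ⧸ Ideal.span (Set.range c)) := isDomain_quotient_span_of_span_eq_maximalIdeal hc𝔪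
  haveI : IsRegularRing (X.presheaf.stalk (τ x') ⧸ Ideal.span (Set.range c)) :=
    isRegularRing_quotient_span_of_span_eq_maximalIdeal hc𝔪
  exact isRegularLocalRing_stalk_quotient_strictTransform_tieCubic hτ K x' hx' c hcJ hc v w h3 hv hw hΨ hK hx'St

end Point

end Summit.ResolutionOfSingularities.ResolutionOfSingularities.Cruxes.EquisingularLiftNat.Sections

end
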